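import Summits.CriticalPhenomena.PercolationContinuityZ3.Theorems.SubpolynomialBlocking.Negative.OffCritical
import Literature.Probability.Percolation.Crossings
import Literature.Probability.Percolation.LatticeSymmetry
import Literature.Probability.Percolation.BondPercolationBlockIndependence
import Literature.Probability.Percolation.HalfSpacePinnedPairs
import Literature.Probability.Percolation.IsoradialArmExtension
import Literature.Probability.Percolation.RSW
import HarnessLib

/-!
# Crux `PercNonProliferation.SubpolynomialBlocking` (stmt-CriticalPhenomena-4446), line `cross-sandwich-flat-seal` — stub `stub_upperSandwich`

Helper file for the crux skeleton of line `cross-sandwich-flat-seal` (lead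
prover-line-stmt-CriticalPhenomena-4446-0). Proves exactly the registered stub signature
`stub_upperSandwich`; lands with `--supports stmt-CriticalPhenomena-4446`.

## The statement (necessity certificate `u_n ≤ q_n⁶`, `n ≥ 2`)

`u_n := blockProb 3 p_c n = P_{p_c}((annulusCrossing 3 n)ᶜ)` ("no open path inside `Λ_{2n}` from `Λ_n`
to `∂ⁱⁿΛ_{2n}`") is at most the sixth power of `q_n := P_{p_c}` (the cube `[0,n]³ = Set.Icc 0 ![n,n,n]`
is SEALED across direction `0`, i.e. the complement of the `openCrossing` event between its faces
`{x₀ = 0}` and `{x₀ = n}` inside the cube).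

## The argument (Grimmett 1999, §1.6 lattice symmetry, §2.2 product measure; folklore)

* Six cubes. Shift `[0,n]³` by `(n,-1,-1)` to `Q = [n,2n] × [-1,n-1]²` (`zdShiftIso`) and apply the
  six signed coordinate permutations `z ↦ (i' ↦ s · z (swap 0 i ⁻¹ i'))`, `i : Fin 3`, `s = ±1`
  (`zdSignedPermIso (Equiv.swap 0 i) (fun _ => s)`). The six images are lattice cubes of side `n`
  inside `Λ_{2n}` (`image_cube_subset_box`), with inner face (image of `{x₀ = 0}`) inside `Λ_n`
  (`image_innerFace_subset_box`) and outer face (image of `{x₀ = n}`) on `∂ⁱⁿΛ_{2n}`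
  (`image_outerFace_subset_innerBoundary`); they are pairwise VERTEX-disjoint for `n ≥ 2`: along
  its own axis `i` a point of cube `(i,s)` has `|z_i| ≥ n` and `s z_i > 0`, across it `|z_j| ≤ n-1`
  (`pairwise_disjoint_image_cube`).
* (a) Deterministic inclusion: an open crossing of such a cube between its two faces, inside the cube,
  is an annulus crossing (`openConnIn_mono`), so blocking ⊆ each of the six seals
  (`openCrossing_subset_annulusCrossing`).
* (b) Independence: the seal of a region `S` is measurable for the σ-algebra of the pairs inside `S`
  (`determinedBy_openConnIn`, `DeterminedBy.measurableSet_edgeSigma`), and σ-algebras of pairwise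
  disjoint edge sets are mutually independent under `P_p` (`bondPercolation_iIndep_edgeSigma`), whence
  `P(⋂ seals) = ∏ P(seal)` (`real_iInter_compl_openCrossing`).
* (c) Symmetry: a graph automorphism carries the seal of `[0,n]³` to the seal of its image with the
  same probability (`bondPercolation_real_image`, `real_compl_openCrossing_image`; measurability of
  open crossings of countable graphs: the tree's `IsoradialArmExtension.measurableSet_openCrossing'`).

Hence `u_n ≤ P(⋂ₖ sealₖ) = ∏ₖ P(sealₖ) = q_n⁶`. No new definitions; no named facts.
-/

noncomputable section

namespace Summit.CriticalPhenomena.PercolationContinuityZ3.Theorems.SubpolynomialBlocking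

open MeasureTheory Filter Topology ProbabilityTheory
open Literature.Probability.Percolation Literature.Probability.LatticeModels
open Literature.Probability.Percolation.DCT16
open Literature.Barriers.CriticalPhenomena
open Summit.CriticalPhenomena.PercolationContinuityZ3.Theorems.SubpolynomialBlocking.Negative

namespace StubUpperSandwich

variable {V : Type*}

/-! ### Seals of regions: measurability, independence, symmetry (any countable graph) -/

/-- The open-crossing event `C(S; A, B)` is measurable for the σ-algebra `σ(S.sym2)` generated by the
pairs inside `S` (`determinedBy_openConnIn` + `DeterminedBy.measurableSet_edgeSigma`; Grimmett 1999 §2.2). -/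
theorem measurableSet_edgeSigma_openCrossing [Countable V] (S A B : Set V) :
    MeasurableSet[edgeSigma S.sym2] (openCrossing S A B : Set (BondConfig V)) := by
  have h : openCrossing S A B = ⋃ x ∈ A, ⋃ y ∈ B, (openConnIn S x y : Set (BondConfig V)) := by
    ext ω
    simp only [mem_openCrossing_iff, Set.mem_iUnion, exists_prop]
  rw [h]
  exact MeasurableSet.biUnion (Set.to_countable A) fun x _ =>
    MeasurableSet.biUnion (Set.to_countable B) fun y _ =>
      (determinedBy_openConnIn S x y subset_rfl).measurableSet_edgeSigma
        (measurableSet_openConnIn_of_countable S x y)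

/-- **Seals of pairwise vertex-disjoint regions are independent** (product measure, Grimmett 1999 §2.2):
`P_p(⋂ₖ C(Sₖ; Aₖ, Bₖ)ᶜ) = ∏ₖ P_p(C(Sₖ; Aₖ, Bₖ)ᶜ)` for a finite family of pairwise disjoint `Sₖ`
(`bondPercolation_iIndep_edgeSigma` for the pairwise disjoint edge sets `Sₖ.sym2`). -/
theorem real_iInter_compl_openCrossing [Countable V] (G : SimpleGraph V) (p : unitInterval)
    {κ : Type*} [Fintype κ] (S A B : κ → Set V) (hS : Pairwise fun k l => Disjoint (S k) (S l)) :
    (bondPercolation G p).real (⋂ k, (openCrossing (S k) (A k) (B k))ᶜ) =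
      ∏ k, (bondPercolation G p).real (openCrossing (S k) (A k) (B k))ᶜ := by
  have hind := bondPercolation_iIndep_edgeSigma G p (fun k => (S k).sym2) (fun k l hkl => by
    show Disjoint (S k).sym2 (S l).sym2
    rw [Set.disjoint_iff_inter_eq_empty, ← Set.sym2_inter, (hS hkl).inter_eq, Set.sym2_empty])
  have h := hind.meas_iInter (s := fun k => (openCrossing (S k) (A k) (B k))ᶜ)
    fun k => (measurableSet_edgeSigma_openCrossing (S k) (A k) (B k)).compl
  simp only [measureReal_def]
  rw [h, ENNReal.toReal_prod]

/-- **Seals of isomorphic regions are equally likely** (Grimmett 1999 §1.6): for a graph isomorphism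
`φ : G ≃g H`, `P_p^H(C(φS; φA, φB)ᶜ) = P_p^G(C(S; A, B)ᶜ)` (`bondPercolation_real_image` and complements). -/
theorem real_compl_openCrossing_image {W : Type*} [Countable V] [Countable W]
    {G : SimpleGraph V} {H : SimpleGraph W} (φ : G ≃g H) (p : unitInterval) (S A B : Set V) :
    (bondPercolation H p).real (openCrossing (φ '' S) (φ '' A) (φ '' B))ᶜ =
      (bondPercolation G p).real (openCrossing S A B)ᶜ := by
  rw [probReal_compl_eq_one_sub (IsoradialArmExtension.measurableSet_openCrossing' _ _ _),
    probReal_compl_eq_one_sub (IsoradialArmExtension.measurableSet_openCrossing' _ _ _),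
    bondPercolation_real_image]


/-! ### Geometry of the six cubes `σ_{i,s}([n,2n] × [-1,n-1]²)` -/

/-- Membership in the cube `[0,n]³`, coordinatewise. -/
theorem mem_cube_iff {n : ℕ} {x : Site 3} :
    x ∈ Set.Icc (0 : Site 3) ![(n : ℤ), (n : ℤ), (n : ℤ)] ↔
      (0 ≤ x 0 ∧ 0 ≤ x 1 ∧ 0 ≤ x 2) ∧ (x 0 ≤ n ∧ x 1 ≤ n ∧ x 2 ≤ n) := by
  simp [Set.mem_Icc, Pi.le_def, Fin.forall_fin_succ]

/-- The shifted cube `[n,2n] × [-1,n-1]²` lies in `Λ_{2n}` (`n ≥ 1`). -/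
theorem shift_mem_box_two_mul {n : ℕ} (hn : 1 ≤ n) {x : Site 3}
    (hx : x ∈ Set.Icc (0 : Site 3) ![(n : ℤ), (n : ℤ), (n : ℤ)]) :
    x + ![(n : ℤ), -1, -1] ∈ box 3 (2 * n) := by
  rw [mem_cube_iff] at hx
  rw [mem_box]
  intro j
  fin_cases j <;> simp only [Pi.add_apply] <;> simp <;> omega

/-- The inner face `{n} × [-1,n-1]²` of the shifted cube lies in `Λ_n` (`n ≥ 1`). -/
theorem shift_mem_box_of_face {n : ℕ} (hn : 1 ≤ n) {x : Site 3}
    (hx : x ∈ Set.Icc (0 : Site 3) ![(n : ℤ), (n : ℤ), (n : ℤ)]) (h0 : x 0 = 0) :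
    x + ![(n : ℤ), -1, -1] ∈ box 3 n := by
  rw [mem_cube_iff] at hx
  rw [mem_box]
  intro j
  fin_cases j <;> simp only [Pi.add_apply] <;> simp <;> omega

/-- Each of the six cubes lies in `Λ_{2n}`. -/
theorem image_cube_subset_box {n : ℕ} (hn : 1 ≤ n) (i : Fin 3) (s : ℤˣ) :
    zdSignedPermIso (Equiv.swap (0 : Fin 3) i) (fun _ => s) ''
        (zdShiftIso (![(n : ℤ), -1, -1] : Site 3) '' Set.Icc (0 : Site 3) ![(n : ℤ), (n : ℤ), (n : ℤ)]) ⊆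
      (↑(box 3 (2 * n)) : Set (Site 3)) := by
  rintro _ ⟨y, ⟨x, hx, rfl⟩, rfl⟩
  exact (signedPerm_mem_box_iff _ _).2 (shift_mem_box_two_mul hn hx)

/-- The inner face of each of the six cubes lies in `Λ_n`. -/
theorem image_innerFace_subset_box {n : ℕ} (hn : 1 ≤ n) (i : Fin 3) (s : ℤˣ) :
    zdSignedPermIso (Equiv.swap (0 : Fin 3) i) (fun _ => s) ''
        (zdShiftIso (![(n : ℤ), -1, -1] : Site 3) ''
          {x | x ∈ Set.Icc (0 : Site 3) ![(n : ℤ), (n : ℤ), (n : ℤ)] ∧ x 0 = 0}) ⊆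
      (↑(box 3 n) : Set (Site 3)) := by
  rintro _ ⟨y, ⟨x, ⟨hx, h0⟩, rfl⟩, rfl⟩
  exact (signedPerm_mem_box_iff _ _).2 (shift_mem_box_of_face hn hx h0)

/-- The outer face of each of the six cubes lies on `∂ⁱⁿΛ_{2n}`. -/
theorem image_outerFace_subset_innerBoundary {n : ℕ} (hn : 1 ≤ n) (i : Fin 3) (s : ℤˣ) :
    zdSignedPermIso (Equiv.swap (0 : Fin 3) i) (fun _ => s) ''
        (zdShiftIso (![(n : ℤ), -1, -1] : Site 3) ''
          {y | y ∈ Set.Icc (0 : Site 3) ![(n : ℤ), (n : ℤ), (n : ℤ)] ∧ y 0 = (n : ℤ)}) ⊆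
      (↑(innerBoundary (zdGraph 3) (box 3 (2 * n))) : Set (Site 3)) := by
  rintro _ ⟨y, ⟨x, ⟨hx, h0⟩, rfl⟩, rfl⟩
  refine mem_innerBoundary_box_of_natAbs_eq (i := i)
    ((signedPerm_mem_box_iff _ _).2 (shift_mem_box_two_mul hn hx)) ?_
  simp only [zdSignedPermIso_apply, Site.signedPerm_apply, Equiv.symm_swap, Equiv.swap_apply_right,
    zdShiftIso_apply, Pi.add_apply, Matrix.cons_val_zero, h0, Int.natAbs_mul, Int.units_natAbs,
    one_mul]
  omega

/-- Along its own axis `i`, the cube `(i, s)` has `|z_i| ≥ n` and `s z_i > 0` (`n ≥ 1`). -/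
theorem natAbs_apply_self_of_mem_image {n : ℕ} (hn : 1 ≤ n) (i : Fin 3) (s : ℤˣ) {z : Site 3}
    (hz : z ∈ zdSignedPermIso (Equiv.swap (0 : Fin 3) i) (fun _ => s) ''
        (zdShiftIso (![(n : ℤ), -1, -1] : Site 3) '' Set.Icc (0 : Site 3) ![(n : ℤ), (n : ℤ), (n : ℤ)])) :
    n ≤ (z i).natAbs ∧ 0 < (s : ℤ) * z i := by
  obtain ⟨y, ⟨x, hx, rfl⟩, rfl⟩ := hz
  rw [mem_cube_iff] at hx
  simp only [zdSignedPermIso_apply, Site.signedPerm_apply, Equiv.symm_swap, Equiv.swap_apply_right,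
    zdShiftIso_apply, Pi.add_apply, Matrix.cons_val_zero, ← mul_assoc, Int.units_coe_mul_self,
    one_mul, Int.natAbs_mul, Int.units_natAbs]
  omega

/-- Across its axis, the cube `(i, s)` has `|z_j| ≤ n - 1` for `j ≠ i` (`n ≥ 2`). -/
theorem natAbs_apply_ne_of_mem_image {n : ℕ} (hn : 2 ≤ n) (i : Fin 3) (s : ℤˣ) {z : Site 3}
    (hz : z ∈ zdSignedPermIso (Equiv.swap (0 : Fin 3) i) (fun _ => s) ''
        (zdShiftIso (![(n : ℤ), -1, -1] : Site 3) '' Set.Icc (0 : Site 3) ![(n : ℤ), (n : ℤ), (n : ℤ)]))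
    {j : Fin 3} (hj : j ≠ i) : (z j).natAbs + 1 ≤ n := by
  obtain ⟨y, ⟨x, hx, rfl⟩, rfl⟩ := hz
  rw [mem_cube_iff] at hx
  have hc : Equiv.swap (0 : Fin 3) i j ≠ 0 := by
    rw [Ne, Equiv.swap_apply_eq_iff, Equiv.swap_apply_left]
    exact hj
  generalize hc' : Equiv.swap (0 : Fin 3) i j = c at hc
  simp only [zdSignedPermIso_apply, Site.signedPerm_apply, Equiv.symm_swap, hc', zdShiftIso_apply,
    Pi.add_apply, Int.natAbs_mul, Int.units_natAbs, one_mul]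
  fin_cases c
  · exact absurd rfl hc
  · simp; omega
  · simp; omega

/-- The six cubes are pairwise vertex-disjoint (`n ≥ 2`). -/
theorem pairwise_disjoint_image_cube {n : ℕ} (hn : 2 ≤ n) :
    Pairwise fun k l : Fin 3 × ℤˣ => Disjoint
      (zdSignedPermIso (Equiv.swap (0 : Fin 3) k.1) (fun _ => k.2) ''
        (zdShiftIso (![(n : ℤ), -1, -1] : Site 3) '' Set.Icc (0 : Site 3) ![(n : ℤ), (n : ℤ), (n : ℤ)]))
      (zdSignedPermIso (Equiv.swap (0 : Fin 3) l.1) (fun _ => l.2) ''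
        (zdShiftIso (![(n : ℤ), -1, -1] : Site 3) '' Set.Icc (0 : Site 3) ![(n : ℤ), (n : ℤ), (n : ℤ)])) := by
  rintro ⟨i, s⟩ ⟨j, t⟩ hkl
  rw [Set.disjoint_left]
  intro z hz hz'
  have hn1 : 1 ≤ n := by omega
  by_cases hij : i = j
  · subst hij
    have hst : s ≠ t := fun h => hkl (by rw [h])
    have h1 := (natAbs_apply_self_of_mem_image hn1 i s hz).2
    have h2 := (natAbs_apply_self_of_mem_image hn1 i t hz').2
    rw [Int.units_ne_iff_eq_neg] at hst
    subst hst
    rw [Units.val_neg, neg_mul] at h1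
    omega
  · have h1 := (natAbs_apply_self_of_mem_image hn1 i s hz).1
    have h2 := natAbs_apply_ne_of_mem_image hn j t hz' hij
    omega

/-- A crossing of a region of `Λ_{2n}` from a subset of `Λ_n` to a subset of `∂ⁱⁿΛ_{2n}` crosses the annulus. -/
theorem openCrossing_subset_annulusCrossing {n : ℕ} {S A B : Set (Site 3)}
    (hS : S ⊆ ↑(box 3 (2 * n))) (hA : A ⊆ ↑(box 3 n))
    (hB : B ⊆ ↑(innerBoundary (zdGraph 3) (box 3 (2 * n)))) :
    (openCrossing S A B : Set (BondConfig (Site 3))) ⊆ annulusCrossing 3 n := by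
  rintro ω ⟨a, ha, b, hb, hab⟩
  exact ⟨a, hA ha, b, hB hb, openConnIn_mono hS a b hab⟩

end StubUpperSandwich

open StubUpperSandwich in
/-- **Registered stub `stub_upperSandwich`** (necessity certificate of line `cross-sandwich-flat-seal`):
`u_n ≤ q_n⁶` for `n ≥ 2` — the blocking event `(annulusCrossing 3 n)ᶜ` lies in the sealing event of
each of six pairwise vertex-disjoint lattice cubes of side `n` in the shell `Λ_{2n} ∖ Λ_{n-1}` (signed
coordinate permutations of `[n,2n] × [-1,n-1]²`), these six events are independent (disjoint edge
sets, product measure) and each has the probability `q_n` of sealing `[0,n]³` (lattice symmetry). -/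
theorem stub_upperSandwich :
    ∀ n : ℕ, 2 ≤ n →
      blockProb 3 (criticalProbI 3) n ≤
        (bondPercolation (zdGraph 3) (criticalProbI 3)).real
          (openCrossing (Set.Icc (0 : Site 3) ![(n : ℤ), (n : ℤ), (n : ℤ)])
            {x | x ∈ Set.Icc (0 : Site 3) ![(n : ℤ), (n : ℤ), (n : ℤ)] ∧ x 0 = 0}
            {y | y ∈ Set.Icc (0 : Site 3) ![(n : ℤ), (n : ℤ), (n : ℤ)] ∧ y 0 = (n : ℤ)})ᶜ ^ 6 := by
  intro n hn
  have hn1 : 1 ≤ n := by omega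
  -- the six cubes, their inner and outer faces, as images of `[0,n]³` and its two faces
  set C : Set (Site 3) := Set.Icc (0 : Site 3) ![(n : ℤ), (n : ℤ), (n : ℤ)]
  set A : Set (Site 3) := {x | x ∈ Set.Icc (0 : Site 3) ![(n : ℤ), (n : ℤ), (n : ℤ)] ∧ x 0 = 0}
  set B : Set (Site 3) := {y | y ∈ Set.Icc (0 : Site 3) ![(n : ℤ), (n : ℤ), (n : ℤ)] ∧ y 0 = (n : ℤ)}
  set τ : zdGraph 3 ≃g zdGraph 3 := zdShiftIso (![(n : ℤ), -1, -1] : Site 3)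
  set ψ : Fin 3 × ℤˣ → zdGraph 3 ≃g zdGraph 3 :=
    fun k => zdSignedPermIso (Equiv.swap (0 : Fin 3) k.1) (fun _ => k.2)
  set μ := bondPercolation (zdGraph 3) (criticalProbI 3) with hμ
  -- (a) blocking ⊆ each seal
  have hsub : (annulusCrossing 3 n)ᶜ ⊆
      ⋂ k, (openCrossing (ψ k '' (τ '' C)) (ψ k '' (τ '' A)) (ψ k '' (τ '' B)))ᶜ := by
    refine Set.subset_iInter fun k => Set.compl_subset_compl.2 ?_
    exact openCrossing_subset_annulusCrossing (image_cube_subset_box hn1 k.1 k.2)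
      (image_innerFace_subset_box hn1 k.1 k.2) (image_outerFace_subset_innerBoundary hn1 k.1 k.2)
  -- (b) independence
  have hprod : μ.real (⋂ k, (openCrossing (ψ k '' (τ '' C)) (ψ k '' (τ '' A)) (ψ k '' (τ '' B)))ᶜ) =
      ∏ k, μ.real (openCrossing (ψ k '' (τ '' C)) (ψ k '' (τ '' A)) (ψ k '' (τ '' B)))ᶜ :=
    real_iInter_compl_openCrossing (zdGraph 3) (criticalProbI 3) (fun k => ψ k '' (τ '' C))
      (fun k => ψ k '' (τ '' A)) (fun k => ψ k '' (τ '' B)) (pairwise_disjoint_image_cube hn)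
  -- (c) symmetry
  have hsymm : ∀ k, μ.real (openCrossing (ψ k '' (τ '' C)) (ψ k '' (τ '' A)) (ψ k '' (τ '' B)))ᶜ =
      μ.real (openCrossing C A B)ᶜ := fun k => by
    rw [hμ, real_compl_openCrossing_image, real_compl_openCrossing_image]
  calc blockProb 3 (criticalProbI 3) n = μ.real (annulusCrossing 3 n)ᶜ := rfl
    _ ≤ μ.real (⋂ k, (openCrossing (ψ k '' (τ '' C)) (ψ k '' (τ '' A)) (ψ k '' (τ '' B)))ᶜ) :=
        measureReal_mono hsub
    _ = ∏ _k : Fin 3 × ℤˣ, μ.real (openCrossing C A B)ᶜ := by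
        rw [hprod]; exact Finset.prod_congr rfl fun k _ => hsymm k
    _ = μ.real (openCrossing C A B)ᶜ ^ 6 := by
        rw [Finset.prod_const, Finset.card_univ, Fintype.card_prod, Fintype.card_fin,
          Fintype.card_units_int]

end Summit.CriticalPhenomena.PercolationContinuityZ3.Theorems.SubpolynomialBlocking

end
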